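import Mathlib
import HarnessLib
import Summits.Ventures.LatticeQCDFlow.Scaling.AcceptanceKLFloorIntegral
import Summits.Ventures.LatticeQCDFlow.Scaling.AutoregressiveProposalAcceptanceChain
import Summits.Ventures.LatticeQCDFlow.Scaling.AutoregressiveProposalKLChain

/-!
# LatticeQCDFlow / Scaling — MULTIPLICATIVE ACCUMULATION: an exact sampler with an autoregressive
# proposal accepts at rate `≥ ½·exp(−2 Σ_k κ_k)`, `κ_k` the mean conditional divergence at step `k`

HONEST FRAMING: exact (Metropolis-corrected) sampling algorithms for lattice gauge theory;
figures of merit are autocorrelation/cost numbers at stated couplings and volumes; no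
continuum-physics claim.

Venture `LatticeQCDFlow` (cell pub-lqcd), topic `Scaling`, FANOUT row 30 (lean-1, GEN-19) — OUR WORK:
the KL chain rule `Scaling/AutoregressiveProposalKLChain` (`D(p‖H) = Σ_k κ_k`, `κ_k ≥ 0`) fed into
row 3's general-space floor `Scaling/AcceptanceKLFloorIntegral`
(`half_exp_neg_two_mul_kl_fwd_le_meanAccept`: `½e^{−2D(p‖q)} ≤ acc(p, q)`).

## What is proved

**`meanAccept_ge_half_exp_of_arHybrid`** [ours] — setting of the KL chain rule (`π = ⊗μ`, target
`0 < c_F ≤ F ≤ C_F`, `Z = ∫F dπ`; block `l` with measurable conditionals `0 < c_q ≤ q_{a_k} ≤ C_q`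
normalised in `a_k` and not reading the later coordinates of `l`; hybrid proposal
`H = (∏_k q_{a_k})·A_{s_0}F/Z`):
`½·exp(−2·Σ_k ∫ (F/Z) log(A_{s_k}F/(q_{a_k}A_{s_{k−1}}F)) dπ) ≤ ∫∫ min((F(x)/Z)H(y), (F(y)/Z)H(x)) dπ dπ`.

READING (value-free): per-coordinate mean conditional divergences `κ_k` cost the exact sampler at most
a factor `e^{−2κ_k}` of equilibrium acceptance EACH — over `V` links with `κ_k ≤ κ` the acceptance is
`≥ ½e^{−2Vκ}`: conditionals accurate to `κ = O(1/V)` nats keep the acceptance bounded below uniformly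
in the volume.  With the necessity file: a conditional blind at one endpoint of a gauge link has
`L¹` error `≥ ⟨W₁ₓ₁⟩` and caps the acceptance at `1 − ⟨W₁ₓ₁⟩/4` however small the other `κ_k` are.
NOT CLAIMED: a ceiling in terms of the `κ_k` (none exists: `Scaling/AcceptanceNoKLCeiling`); sharp
constants.  No `def`, no `sorry`, nothing cited as a fact.
-/

noncomputable section

namespace Summit.Ventures.LatticeQCDFlow.Theory2.Autoregressive

open MeasureTheory Function Set
open Summit.Ventures.LatticeQCDFlow.Exactness

variable {ι : Type*} [Fintype ι] [DecidableEq ι] {X : Type*} [MeasurableSpace X]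
variable (μ : Measure X) [IsProbabilityMeasure μ]

set_option maxHeartbeats 400000 in
/-- **`ā ≥ ½·exp(−2 Σ_k κ_k)` FOR AN AUTOREGRESSIVE PROPOSAL.** [ours] -/
theorem meanAccept_ge_half_exp_of_arHybrid {q : ι → (ι → X) → ℝ} (hqm : ∀ a, Measurable (q a))
    {cq Cq : ℝ} (hcq : 0 < cq) (hqlo : ∀ a ω, cq ≤ q a ω) (hqhi : ∀ a ω, q a ω ≤ Cq)
    (hq1 : ∀ a ω, ∫ v, q a (update ω a v) ∂μ = 1)
    {F : (ι → X) → ℝ} (hFm : Measurable F) {cF CF : ℝ} (hcF : 0 < cF) (hFlo : ∀ ω, cF ≤ F ω)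
    (hFhi : ∀ ω, F ω ≤ CF) (l : List ι)
    (hpw : l.Pairwise (fun a b => ∀ ω v, q a (update ω b v) = q a ω)) :
    Real.exp (-(2 * ((l.zip l.tails.tail).map fun c : ι × List ι =>
        ∫ ω, F ω / (∫ η, F η ∂Measure.pi (fun _ : ι => μ)) *
          Real.log (coordAvg μ c.2.toFinset F ω / (q c.1 ω * coordAvg μ (c.1 :: c.2).toFinset F ω))
          ∂Measure.pi (fun _ : ι => μ)).sum)) / 2 ≤
      ∫ x, ∫ y, min
          (F x / (∫ η, F η ∂Measure.pi (fun _ : ι => μ)) *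
            ((l.map fun b => q b y).prod * coordAvg μ l.toFinset F y /
              ∫ η, F η ∂Measure.pi (fun _ : ι => μ)))
          (F y / (∫ η, F η ∂Measure.pi (fun _ : ι => μ)) *
            ((l.map fun b => q b x).prod * coordAvg μ l.toFinset F x /
              ∫ η, F η ∂Measure.pi (fun _ : ι => μ)))
          ∂Measure.pi (fun _ : ι => μ) ∂Measure.pi (fun _ : ι => μ) := by
  obtain ⟨x₀⟩ := MeasureTheory.nonempty_of_isProbabilityMeasure μ
  have ω₀ : ι → X := fun _ => x₀
  set Z : ℝ := ∫ η, F η ∂Measure.pi (fun _ : ι => μ) with hZdef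
  have hF0 : ∀ ω, 0 < F ω := fun ω => hcF.trans_le (hFlo ω)
  have hFabs : ∀ ω, |F ω| ≤ CF := fun ω => by rw [abs_of_pos (hF0 ω)]; exact hFhi ω
  have hq0 : ∀ a ω, 0 < q a ω := fun a ω => hcq.trans_le (hqlo a ω)
  have hCF : 0 < CF := (hF0 ω₀).trans_le (hFhi ω₀)
  -- a positive upper constant for the conditionals
  set CU : ℝ := max Cq 1 with hCU
  have hCU0 : 0 < CU := lt_of_lt_of_le one_pos (le_max_right _ _)
  have hqU : ∀ a ω, q a ω ≤ CU := fun a ω => (hqhi a ω).trans (le_max_left _ _)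
  have hZpos : 0 < Z := by
    have h1 : ∫ _, cF ∂Measure.pi (fun _ : ι => μ) ≤ Z :=
      integral_mono (integrable_const cF) (integrable_pi_of_abs_le μ hFm hFabs) hFlo
    have h2 : ∫ _, cF ∂Measure.pi (fun _ : ι => μ) = cF := by
      rw [integral_const, smul_eq_mul, Measure.real, measure_univ, ENNReal.toReal_one, one_mul]
    linarith
  -- the block product and the context marginal
  obtain ⟨hPm, hP0, hPb⟩ := arProd_props hqm (fun a ω => (hq0 a ω).le) hqU hCU0.le l
  have hPpos : ∀ ω, 0 < (l.map fun b => q b ω).prod := fun ω => arProd_pos hq0 l ω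
  have hPlo : ∀ ω, cq ^ l.length ≤ (l.map fun b => q b ω).prod := fun ω =>
    (arProd_bounds hcq hqlo hqU ω l).1
  set A := coordAvg μ l.toFinset F with hA
  have hAf := fun ω => coordAvg_pos_of_le μ l.toFinset hFm hcF hFlo hFhi ω
  have hAm : Measurable A := measurable_coordAvg μ l.toFinset hFm
  have hAb : ∀ ω, |A ω| ≤ CF := abs_coordAvg_le_of_abs_le μ l.toFinset hFm hFabs
  have hAl : ∀ b ∈ l, ∀ ω v, A (update ω b v) = A ω := by
    intro b hb ω v
    rw [hA, ← Finset.insert_eq_of_mem (List.mem_toFinset.2 hb)]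
    exact coordAvg_insert_update μ _ b F ω v
  -- target density `p = F/Z`
  have hpm : Measurable fun ω => F ω / Z := hFm.div_const Z
  have hp0 : ∀ ω, 0 < F ω / Z := fun ω => div_pos (hF0 ω) hZpos
  have hpi : Integrable (fun ω => F ω / Z) (Measure.pi fun _ : ι => μ) :=
    integrable_pi_of_abs_le μ hpm (C := CF / Z) (fun ω => by
      rw [abs_of_pos (hp0 ω)]; exact div_le_div_of_nonneg_right (hFhi ω) hZpos.le)
  have hp1 : ∫ ω, F ω / Z ∂Measure.pi (fun _ : ι => μ) = 1 := by
    rw [integral_div, ← hZdef, div_self hZpos.ne']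
  -- proposal density `H = Π·A/Z`
  have hHm : Measurable fun ω => (l.map fun b => q b ω).prod * A ω / Z := (hPm.mul hAm).div_const Z
  have hH0 : ∀ ω, 0 < (l.map fun b => q b ω).prod * A ω / Z := fun ω =>
    div_pos (mul_pos (hPpos ω) (hAf ω).1) hZpos
  have hPAm : Measurable fun ω => (l.map fun b => q b ω).prod * A ω := hPm.mul hAm
  have hPAb : ∀ ω, |(l.map fun b => q b ω).prod * A ω| ≤ CU ^ l.length * CF := fun ω => by
    rw [abs_mul, abs_of_nonneg (hP0 ω)]
    exact mul_le_mul (hPb ω) (hAb ω) (abs_nonneg _) (pow_nonneg hCU0.le _)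
  have hHi : Integrable (fun ω => (l.map fun b => q b ω).prod * A ω / Z) (Measure.pi fun _ : ι => μ) :=
    (integrable_pi_of_abs_le μ hPAm hPAb).div_const Z
  have hH1 : ∫ ω, (l.map fun b => q b ω).prod * A ω / Z ∂Measure.pi (fun _ : ι => μ) = 1 := by
    rw [integral_div]
    have e : ∫ ω, (l.map fun b => q b ω).prod * A ω ∂Measure.pi (fun _ : ι => μ) = Z := by
      calc ∫ ω, (l.map fun b => q b ω).prod * A ω ∂Measure.pi (fun _ : ι => μ)
          = ∫ ω, A ω * (l.map fun b => q b ω).prod ∂Measure.pi (fun _ : ι => μ) := by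
            simp_rw [mul_comm]
        _ = ∫ ω, A ω ∂Measure.pi (fun _ : ι => μ) :=
            pi_integral_mul_arTail μ hqm (fun a ω => (hq0 a ω).le) hqU hq1 l hpw hAm hAb hAl
        _ = Z := by rw [hA, pi_integral_coordAvg μ l.toFinset hFm hFabs]
    rw [e, div_self hZpos.ne']
  -- integrability of `p·log(p/H)`: after cancelling `Z` the argument `F/(Π·A)` is squeezed
  have hgbd : ∀ ω, cF / (CU ^ l.length * CF) ≤ F ω / ((l.map fun b => q b ω).prod * A ω) ∧
      F ω / ((l.map fun b => q b ω).prod * A ω) ≤ CF / (cq ^ l.length * cF) := fun ω =>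
    div_mem_bounds hcF (mul_pos (pow_pos hcq _) hcF) (hFlo ω) (hFhi ω)
      (mul_le_mul (hPlo ω) (hAf ω).2.1 hcF.le (hP0 ω)) (mul_le_mul (hPb ω) (hAf ω).2.2 (hAf ω).1.le
        (pow_nonneg hCU0.le _))
  have hli : Integrable (fun ω => F ω / Z *
      Real.log ((F ω / Z) / ((l.map fun b => q b ω).prod * A ω / Z))) (Measure.pi fun _ : ι => μ) := by
    have e : (fun ω => F ω / Z * Real.log ((F ω / Z) / ((l.map fun b => q b ω).prod * A ω / Z))) =
        fun ω => F ω / Z * Real.log (F ω / ((l.map fun b => q b ω).prod * A ω)) := by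
      funext ω; rw [div_div_div_cancel_right₀ hZpos.ne']
    rw [e]
    exact integrable_weight_mul_log μ hFm hFabs Z (hFm.div hPAm)
      (div_pos hcF (mul_pos (pow_pos hCU0 _) hCF)) (fun ω => (hgbd ω).1) (fun ω => (hgbd ω).2)
  -- row 3's floor, then the chain rule
  have h3 : Real.exp (-(2 * ∫ ω, F ω / Z *
      Real.log ((F ω / Z) / ((l.map fun b => q b ω).prod * A ω / Z)) ∂Measure.pi (fun _ : ι => μ))) / 2 ≤
      ∫ x, ∫ y, min (F x / Z * ((l.map fun b => q b y).prod * A y / Z))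
        (F y / Z * ((l.map fun b => q b x).prod * A x / Z))
        ∂Measure.pi (fun _ : ι => μ) ∂Measure.pi (fun _ : ι => μ) :=
    Summit.Ventures.LatticeQCDFlow.Theory2.half_exp_neg_two_mul_kl_fwd_le_meanAccept
      (μ := Measure.pi fun _ : ι => μ) hp0 hpm hpi hp1 hH0 hHm hHi hH1 hli
  rw [hA, integral_kl_arHybrid_eq_sum μ hqm hcq hqlo hqhi hFm hcF hFlo hFhi l] at h3
  exact h3

end Summit.Ventures.LatticeQCDFlow.Theory2.Autoregressive

end
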